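import Summits.Langlands.Langlands.Theorems.IrreducibilityBySelfDualityPairLBoundaryJSCornerLocalSingleDatum
import Literature.NumberTheory.Automorphic.ArchRankinSelbergGapTestVector

/-!
# Crux `PairLBoundaryJS` (stmt-Langlands-13622), line `Sketch` — stub `stub_gap_local_single_datum` (G-LSD),
# part 1: ONE archimedean `GL_n × GL_m` datum inside the translated gap box integral, GRANTED the gap product form

Summit `Langlands`, sub-problem `Langlands`, helper file under `Theorems/` supporting the crux
`PairLBoundaryJS` (Arthur–Clozel (1989), Ch. 3, (2.2)), line `Sketch`, registered stub
`stub_gap_local_single_datum` (part 1 of 2; part 2, `…GapLocalSingleDatum`, specialises the theorem of this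
file to the gap product form `GapUnitBoxProductForm.stub_gap_unitBox_productForm`). This file proves the
registered bookkeeping sub-stub `stub_gap_lsd_integral_places` and the conditional theorem
`gap_local_single_datum_of_productForm`.

The per-datum core of the local Rankin–Selberg theory of a cuspidal pair `(P, Q)`, `P` cuspidal on
`GL_n(𝔸_K)`, `Q` cuspidal on `GL_m(𝔸_K)`, `0 < m < n`, in translate form (Jacquet–Piatetski-Shapiro–Shalika
(1983), (2.7) at the finite places of `S₀`, by spread data; Cogdell (2004), §4.1, `Ψ = ∏_v Ψ_v` for
factorizable data): the `GL_n × GL_m` transcription of `CornerLocalSingleDatum.stub_corner_local_single_datum`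
(the pair `(m+1, m)`). Given torus shifts `τ ∈ (𝔸_Kˣ)ᵐ`, `T ∈ (𝔸_Kˣ)ⁿ` with `D' = diag τ`, `D = diag T`
trivial at `S₀ ∪ ∞` (`D` an INDEPENDENT torus element, not `ι(D')`), pure tensors `S₁ ∈ π_f`, `S₁' ∈ σ_f` of
levels `K_f(𝔫P)`, `K_f(𝔫Q)` with `𝔫P 𝔫Q` supported on `S₀`, and `K_∞`-finite Gårding vectors `e`, `e'` of the
archimedean components `τP`, `τQ`, there are a level `𝔫` supported on `S₀`, HONEST continuous cusp forms
`Φ = S_η f`, `Φ' = S_{η'} f'` (right `K(𝔫)`-invariant, representing `f ∈ π`, `f' ∈ σ`) and `κ > 0` with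
`∫_{B({v ∉ S₀}) × K} W_Φ(D ι ·) W̄_{Φ'}(D' ·) |det|^s δ⁻¹ = κ · Ψ^{(n,m)}_∞(s; Φ_λ(D_f S₁), Φ_λ'(D'_f S₁'), e, e')`
for every `s` (`ι = glCorner (m ≤ n)`, `archGapPairIntegralCplx` against the image Haar measures), GRANTED the
support collapse and product form of the translated gap pair integrand on the unit box — the registered
neighbour stub `stub_gap_unitBox_productForm`, taken VERBATIM as a hypothesis. The assembly is that of the
corner file: the finite set `S₁₀` (disjoint from `S₀`) off which BOTH `diag τ` and `diag T` are integral
(`stub_gap_lsd_integral_places`) and conjugation control `D_f⁻¹ K_f(𝔫P 𝔞) D_f ≤ K_f(𝔫P)`,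
`D'_f⁻¹ K_f(𝔫Q 𝔞') D'_f ≤ K_f(𝔫Q)` (`InitialVectorTranslateNeZero.exists_forall_conj_mem_finitePrincipalCongruenceLevel`);
the initial pure tensors `f₁ = Ŝ₁ e`, `f₁' = Ŝ₁' e'`, Harish-Chandra's level-fixing bumps
(`ArchLevelWeightFixingPair.stub_archLevelWeight_fixing_pair`), the spread datum `f = E_L f₁` with `T₀ := S₀`
and partner level `𝔫Q` (`SpreadPairDatumOfInitialDatum.stub_spreadPairDatum_of_initialDatum`), the rescaled
bump with `S_η f = f`; HONESTY (`exists_memLp_toLp_eq_isCuspFormGL_of_smoothedVector_eq`,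
`exists_spreadIter_intertwiner`); the abstract properties of `W = W_{S_η f}`, `W' = W_{S_{η'} f₁'}`
(`WhittakerCoeffSmoothedFormProps.stub_whittakerCoeff_smoothedForm_props`), the GRANTED product form, the
archimedean values at `D (ι x, 1)` and `D' (x, 1)` (`TranslateArchValue.stub_translate_arch_value`), coset
averaging on `GL_m` (`UnitBoxTranslateAvg.stub_unitBox_translate_avg`) and `archGapPairIntegralCplx_def`.

All proofs complete; tree theorems only.

## References

* H. Jacquet, I. I. Piatetski-Shapiro, J. A. Shalika, *Rankin–Selberg convolutions*, Amer. J. Math.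
  105 (1983), §2, (2.7) [JacquetPiatetskiShapiroShalika1983].
* J. W. Cogdell, *Analytic theory of L-functions for GL_n*, in *An Introduction to the Langlands
  Program* (2004), §1.2, §2.3, §4.1 [CogdellAnalyticTheory2004].
-/

noncomputable section

-- `Summit.Langlands.Langlands.…` (summit = sub-problem name, D-0017 layout) trips `dupNamespace`
set_option linter.dupNamespace false

open scoped MatrixGroups Topology Pointwise ENNReal NNReal ComplexConjugate InnerProductSpace ContDiff
-- the place subtypes indexing `mixedSpace K` are `Fintype` classically (`NormedCommRing (mixedSpace K)`)
open scoped Classical Matrix.Norms.Operator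
open NumberField IsDedekindDomain MeasureTheory Measure Matrix Set Filter WithZero
open NumberField.mixedEmbedding
open Literature.NumberTheory.Automorphic AdelicGroupData
open Literature.NumberTheory.GaloisRepresentations (ideleGroup HeckeCharacter)
open Literature.MeasureTheory.Group
open Literature.RingTheory.SymmetricFunctions.SymmPoly
open ValuativeRel

-- the automorphic quotient carries the tree's Borel σ-algebra, not Mathlib's quotient σ-algebra
attribute [-instance] Quotient.instMeasurableSpace QuotientGroup.measurableSpace

-- the house local instances, exactly as in `RankinSelbergUnfoldingIdentity`
attribute [local instance] adelicBorel borelSpace_adelic locallyCompactSpace_adelic secondCountableTopology_gl_adelic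
  glAdeleBorel borelSpace_glAdele borelSpace_ideleGroup secondCountableTopology_ideleGroup

-- Mathlib idiom: the commutator Lie ring on matrices, to mention `(archGroupGL n K).lie`
attribute [local instance 100] LieRing.ofAssociativeRing

namespace Summit.Langlands.Langlands.Theorems.GapLocalSingleDatum

/-- **SUB-STUB (G-LSD, bookkeeping) — the finite set of places off which two torus shifts are integral**:
for torus elements `τ ∈ (𝔸_Kˣ)ᵐ`, `T ∈ (𝔸_Kˣ)ⁿ` trivial at the places of `S₀` there is a finite set `S₁₀`
DISJOINT from `S₀` off which both `diag τ` and `diag T` have integral local components (ideles are units at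
almost every place, `finite_setOf_exists_valued_ne_one`; at the places of `S₀` the components are `1`).
[folklore] -/
theorem stub_gap_lsd_integral_places :
    ∀ {n m : ℕ} {K : Type} [Field K] [NumberField K] (S₀ : Finset (HeightOneSpectrum (𝓞 K)))
      (τ : Fin m → ideleGroup K) (T : Fin n → ideleGroup K),
      (∀ v ∈ S₀, localComponent v (glDiagonal m (AdeleRing (𝓞 K) K) τ) = 1) →
      (∀ v ∈ S₀, localComponent v (glDiagonal n (AdeleRing (𝓞 K) K) T) = 1) →
      ∃ S₁₀ : Finset (HeightOneSpectrum (𝓞 K)), (∀ v ∈ S₀, v ∉ S₁₀) ∧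
        (∀ v ∉ S₁₀, localComponent v (glDiagonal m (AdeleRing (𝓞 K) K) τ) ∈ glInt m (v.adicCompletion K)) ∧
        (∀ v ∉ S₁₀, localComponent v (glDiagonal n (AdeleRing (𝓞 K) K) T) ∈ glInt n (v.adicCompletion K)) := by
  intro n m K _ _ S₀ τ T hτ hT
  refine ⟨((finite_setOf_exists_valued_ne_one τ).toFinset ∪ (finite_setOf_exists_valued_ne_one T).toFinset) \ S₀,
    fun v hv h => (Finset.mem_sdiff.1 h).2 hv, fun v hv => ?_, fun v hv => ?_⟩
  · by_cases hvS : v ∈ S₀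
    · rw [hτ v hvS]; exact one_mem _
    · refine localComponent_glDiagonal_mem_glInt fun i => by_contra fun hi => hv ?_
      exact Finset.mem_sdiff.2 ⟨Finset.mem_union_left _ ((Set.Finite.mem_toFinset _).2 ⟨i, hi⟩), hvS⟩
  · by_cases hvS : v ∈ S₀
    · rw [hT v hvS]; exact one_mem _
    · refine localComponent_glDiagonal_mem_glInt fun i => by_contra fun hi => hv ?_
      exact Finset.mem_sdiff.2 ⟨Finset.mem_union_right _ ((Set.Finite.mem_toFinset _).2 ⟨i, hi⟩), hvS⟩

set_option maxHeartbeats 1600000 in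
/-- **G-LSD granted G-PF — ONE archimedean `GL_n × GL_m` datum realised inside the translated gap box integral,
GRANTED the gap product form** (the `GL_n × GL_m` analogue of `CornerLocalSingleDatum.stub_corner_local_single_datum`;
Jacquet–Piatetski-Shapiro–Shalika (1983), (2.7) at the finite places of `S₀` by spread data; Cogdell (2004), §4.1,
`Ψ = ∏_v Ψ_v` for factorizable data). The hypothesis is VERBATIM the registered neighbour stub
`stub_gap_unitBox_productForm`. Given torus shifts `τ ∈ (𝔸_Kˣ)ᵐ`, `T ∈ (𝔸_Kˣ)ⁿ` trivial at `S₀ ∪ ∞`, pure tensors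
`S₁ ∈ π_f`, `S₁' ∈ σ_f` of levels `K_f(𝔫P)`, `K_f(𝔫Q)` with `𝔫P 𝔫Q` supported on `S₀`, and `K_∞`-finite Gårding
vectors `e`, `e'` of `τP`, `τQ`, there are a level `𝔫` supported on `S₀`, HONEST continuous representatives `Φ`,
`Φ'` of vectors `sv ∈ π`, `sv' ∈ σ`, right `K(𝔫)`-invariant, and `κ > 0` with, for every `s`,
`∫_{B({v ∉ S₀}) × K} W_Φ(diag(T) ι ·) W̄_{Φ'}(diag τ ·) |det|^s δ⁻¹ = κ · Ψ^{(n,m)}_∞(s; Φ_λ(diag(T)_f S₁), Φ_λ'(diag(τ)_f S₁'), e, e')`.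
[cite: CogdellAnalyticTheory2004, §4.1] [cite: JacquetPiatetskiShapiroShalika1983, §2 (2.7)] -/
theorem gap_local_single_datum_of_productForm
    (hPF : ∀ {n m : ℕ} {K : Type} [Field K] [NumberField K]
      [MeasurableSpace (AdeleRing (𝓞 K) K)] [BorelSpace (AdeleRing (𝓞 K) K)] (_hm : 0 < m) (hmn : m < n)
      (W : GL (Fin n) (AdeleRing (𝓞 K) K) → ℂ) (W' : GL (Fin m) (AdeleRing (𝓞 K) K) → ℂ)
      (_ : ∀ (u : ↥(adelicUnipotent n K)) (g : GL (Fin n) (AdeleRing (𝓞 K) K)),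
        W ((u : GL (Fin n) (AdeleRing (𝓞 K) K)) * g) = whittakerCharFun (adeleAddChar K) u * W g)
      (_ : ∀ (u : ↥(adelicUnipotent m K)) (g : GL (Fin m) (AdeleRing (𝓞 K) K)),
        W' ((u : GL (Fin m) (AdeleRing (𝓞 K) K)) * g) = whittakerCharFun (adeleAddChar K) u * W' g)
      (_ : ∀ (z : ideleGroup K) (g : GL (Fin n) (AdeleRing (𝓞 K) K)),
        ‖W (Matrix.GeneralLinearGroup.scalar (Fin n) z * g)‖ = ‖W g‖)
      {𝔫 : Ideal (𝓞 K)} (_ : 𝔫 ≠ 0)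
      (_ : ∀ u ∈ finitePrincipalCongruenceLevel n K 𝔫, ∀ g : GL (Fin n) (AdeleRing (𝓞 K) K),
        W (g * GLn.ofFinite n K u) = W g)
      (_ : ∀ u ∈ finitePrincipalCongruenceLevel m K 𝔫, ∀ g : GL (Fin m) (AdeleRing (𝓞 K) K),
        W' (g * GLn.ofFinite m K u) = W' g)
      {Bad : Finset (HeightOneSpectrum (𝓞 K))} (_ : ∀ w : HeightOneSpectrum (𝓞 K), w.asIdeal ∣ 𝔫 → w ∈ Bad)
      (τ : Fin m → ideleGroup K) (_ : ∀ v ∈ Bad, localComponent v (glDiagonal m (AdeleRing (𝓞 K) K) τ) = 1)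
      (T : Fin n → ideleGroup K) (_ : ∀ v ∈ Bad, localComponent v (glDiagonal n (AdeleRing (𝓞 K) K) T) = 1)
      (_ : ∀ v ∈ Bad, ∃ (tv : Fin n → (v.adicCompletion K)ˣ) (M c₀ : ℤ),
          IsSpreadWhittakerAt v (adeleAddChar K) tv M W ∧
          (∃ y : v.adicCompletion K, Valued.v y ≤ exp (1 - c₀) ∧ (adeleAddChar K).adicComponent v y ≠ 1) ∧ 1 ≤ M ∧
          (∀ i j : Fin n, i ≤ j → Valued.v (tv j : v.adicCompletion K) ≤ Valued.v (tv i : v.adicCompletion K)) ∧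
          (∀ i j : Fin n, (i : ℕ) + 1 = j →
            exp (M - c₀) * Valued.v (tv j : v.adicCompletion K) ≤ Valued.v (tv i : v.adicCompletion K)) ∧
          ∀ κ ∈ valuedCongruenceSubgroup (Fin m) (exp (-M)), ∀ g : GL (Fin m) (AdeleRing (𝓞 K) K),
            W' (g * GLn.ofLocal m K v κ) = W' g)
      (νA : Measure (Fin m → ideleGroup K)) (νK : Measure ↥(maximalCompactAdelic m K)),
    let I : ℂ → (Fin m → ideleGroup K) × ↥(maximalCompactAdelic m K) → ℂ :=
      fun s => torusPairIntegrandC m K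
        (fun g => W (glDiagonal n (AdeleRing (𝓞 K) K) T * glCorner (AdeleRing (𝓞 K) K) hmn.le g))
        (fun g => star W' (glDiagonal m (AdeleRing (𝓞 K) K) τ * g)) (fun _ => (1 : ℝ)) s
    ∃ (𝔪 : Ideal (𝓞 K)) (_ : 𝔪 ≠ 0) (F : GL (Fin m) (FiniteAdeleRing (𝓞 K) K) → ℂ),
      (∀ g ∈ glFiniteIntegralLevel m K, ∀ u ∈ finitePrincipalCongruenceLevel m K 𝔪, F (g * u) = F g) ∧
      (∀ g, F g = 0 ∨ F g = 1) ∧ F 1 = 1 ∧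
      ∀ s : ℂ,
        (∫ p in unitBox {v | v ∉ (↑Bad : Set (HeightOneSpectrum (𝓞 K)))} ×ˢ Set.univ, I s p ∂(νA.prod νK) =
          ∫ p in unitBox (Set.univ : Set (HeightOneSpectrum (𝓞 K))) ×ˢ Set.univ, I s p ∂(νA.prod νK)) ∧
        ∀ p : (Fin m → ideleGroup K) × ↥(maximalCompactAdelic m K),
          p.1 ∈ unitBox (n := m) (K := K) (Set.univ : Set (HeightOneSpectrum (𝓞 K))) →
          I s p = F (GLn.sndHom m K (torusPoint m K p)) *
            (W (glDiagonal n (AdeleRing (𝓞 K) K) T *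
              GLn.ofInfinite n K (glCorner (mixedSpace K) hmn.le (GLn.toMixed m K (torusPoint m K p)))) *
            conj (W' (glDiagonal m (AdeleRing (𝓞 K) K) τ * GLn.ofInfinite m K (GLn.toMixed m K (torusPoint m K p)))) *
            archTorusWeightC m K s (archTorusOfIdele m K p.1))) :
    ∀ {n m : ℕ} {K : Type} [Field K] [NumberField K]
      {μ : Measure (gl n K).automorphicQuotient} [(gl n K).IsAutomorphicMeasure μ]
      {μ' : Measure (gl m K).automorphicQuotient} [(gl m K).IsAutomorphicMeasure μ']
      [MeasurableSpace (AdeleRing (𝓞 K) K)] [BorelSpace (AdeleRing (𝓞 K) K)] (_hm : 0 < m) (hmn : m < n)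
      (hcpt : isCompact_glFiniteIntegralLevel n K) (hcpt' : isCompact_glFiniteIntegralLevel m K)
      (P : CuspidalAutomorphicRepGL n K μ) (Q : CuspidalAutomorphicRepGL m K μ')
      (νA : Measure (Fin m → ideleGroup K)) [IsHaarMeasure νA]
      (νK : Measure ↥(maximalCompactAdelic m K)) [IsHaarMeasure νK]
      (ν₀ : Measure ↥(adelicUnipotent n K)) [IsHaarMeasure ν₀]
      (ν₀' : Measure ↥(adelicUnipotent m K)) [IsHaarMeasure ν₀']
      {E : Type} [NormedAddCommGroup E] [InnerProductSpace ℂ E] [CompleteSpace E]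
      {τP : ContRepresentation ℂ (archGroupGL n K).carrier E} (hτPc : τP.IsStronglyContinuous)
      {E' : Type} [NormedAddCommGroup E'] [InnerProductSpace ℂ E'] [CompleteSpace E']
      {τQ : ContRepresentation ℂ (archGroupGL m K).carrier E'} (hτQc : τQ.IsStronglyContinuous)
      (S₀ : Finset (HeightOneSpectrum (𝓞 K))) (τ : Fin m → ideleGroup K) (T : Fin n → ideleGroup K)
      (_ : GLn.toMixed m K (glDiagonal m (AdeleRing (𝓞 K) K) τ) = 1)
      (_ : ∀ v ∈ S₀, localComponent v (glDiagonal m (AdeleRing (𝓞 K) K) τ) = 1)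
      (_ : GLn.toMixed n K (glDiagonal n (AdeleRing (𝓞 K) K) T) = 1)
      (_ : ∀ v ∈ S₀, localComponent v (glDiagonal n (AdeleRing (𝓞 K) K) T) = 1)
      {𝔫P 𝔫Q : Ideal (𝓞 K)} (_ : 𝔫P ≠ 0) (_ : 𝔫Q ≠ 0)
      (_ : ∀ w ∉ S₀, ¬ w.asIdeal ∣ 𝔫P * 𝔫Q)
      (S₁ : multiplicityModule hcpt τP P.1)
      (_ : (S₁ : E →L[ℂ] (gl n K).L2 μ) ∈ archIntertwinersLevel hcpt τP P.1 (finitePrincipalCongruenceLevel n K 𝔫P))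
      (S₁' : multiplicityModule hcpt' τQ Q.1)
      (_ : (S₁' : E' →L[ℂ] (gl m K).L2 μ') ∈ archIntertwinersLevel hcpt' τQ Q.1 (finitePrincipalCongruenceLevel m K 𝔫Q))
      (e : archGardingSpace hcpt τP) (e' : archGardingSpace hcpt' τQ)
      (_ : FiniteDimensional ℂ (Submodule.span ℂ (Set.range
        fun κ : ↥(Kinf n K) => τP (toArch hcpt κ.1) e.1)))
      (_ : FiniteDimensional ℂ (Submodule.span ℂ (Set.range
        fun κ : ↥(Kinf m K) => τQ (toArch hcpt' κ.1) e'.1)))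
      [MeasurableSpace (GL (Fin m) (mixedSpace K))] [BorelSpace (GL (Fin m) (mixedSpace K))],
    ∃ (𝔫 : Ideal (𝓞 K)) (_ : 𝔫 ≠ 0) (_ : ∀ w ∉ S₀, ¬ w.asIdeal ∣ 𝔫)
      (Φ : (gl n K).automorphicQuotient → ℂ) (Φ' : (gl m K).automorphicQuotient → ℂ)
      (sv : P.1.toSubmodule) (sv' : Q.1.toSubmodule) (_ : Continuous Φ) (_ : Continuous Φ')
      (_ : ((sv : (gl n K).L2 μ) : _ → ℂ) =ᵐ[μ] Φ)
      (_ : ((sv' : (gl m K).L2 μ') : _ → ℂ) =ᵐ[μ'] Φ')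
      (_ : IsCuspFormGL n K hcpt (invQuot (gl n K) Φ))
      (_ : IsCuspFormGL m K hcpt' (invQuot (gl m K) Φ'))
      (_ : ∀ u ∈ principalCongruenceLevel n K 𝔫, ∀ y, invQuot (gl n K) Φ (y * u :) = invQuot (gl n K) Φ y)
      (_ : ∀ u ∈ principalCongruenceLevel m K 𝔫, ∀ y, invQuot (gl m K) Φ' (y * u :) = invQuot (gl m K) Φ' y)
      (κ : ℝ), 0 < κ ∧
      ∀ s,
        ∫ p in unitBox {v | v ∉ (↑S₀ : Set _)} ×ˢ univ,
          torusPairIntegrandC m K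
            (fun g => whittakerCoeff ν₀ (unipotentTateDomain n K) (adeleAddChar K) (invQuot (gl n K) Φ)
              (glDiagonal n (AdeleRing (𝓞 K) K) T * glCorner (AdeleRing (𝓞 K) K) hmn.le g))
            (fun g => star (whittakerCoeff ν₀' (unipotentTateDomain m K) (adeleAddChar K) (invQuot (gl m K) Φ')
              (glDiagonal m (AdeleRing (𝓞 K) K) τ * g)))
            (fun _ => 1) s p ∂(νA.prod νK) =
        (κ : ℂ) * archGapPairIntegralCplx hmn.le hcpt hcpt' τP hτPc τQ hτQc
          (transferMap (whittakerFunctional ν₀ (continuous_adeleAddChar K) (ContRepresentation.Equiv.refl P.1.toContRep)) hτPc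
            (finComponentRep hcpt τP P.1 (GLn.sndHom n K (glDiagonal n (AdeleRing (𝓞 K) K) T)) S₁))
          (transferMap (whittakerFunctional ν₀' (continuous_adeleAddChar K) (ContRepresentation.Equiv.refl Q.1.toContRep)) hτQc
            (finComponentRep hcpt' τQ Q.1 (GLn.sndHom m K (glDiagonal m (AdeleRing (𝓞 K) K) τ)) S₁')) e e'
          ((νA.restrict (unitBox univ)).map (archTorusOfIdele m K)) (νK.map (kinfOfMaximalCompact m K)) s := by
  intro n m K _ _ μ _ μ' _ _ _ hm hmn
  obtain ⟨m, rfl⟩ : ∃ m', m = m' + 1 := ⟨m - 1, (Nat.succ_pred_eq_of_pos hm).symm⟩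
  obtain ⟨n, rfl⟩ : ∃ n', n = n' + 1 := ⟨n - 1, (Nat.succ_pred_eq_of_pos (hm.trans hmn)).symm⟩
  intro hcpt hcpt' P Q νA _ νK _ ν₀ _ ν₀' _ E _ _ _ τP hτPc E' _ _ _ τQ hτQc S₀ τ T hD'inf hD'S₀ hDinf hDS₀ 𝔫P 𝔫Q h𝔫P h𝔫Q
    hsupp S₁ hS₁ S₁' hS₁' e e' hefin he'fin _ _
  set D' : GL (Fin (m + 1)) (AdeleRing (𝓞 K) K) := glDiagonal (m + 1) (AdeleRing (𝓞 K) K) τ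
  set D : GL (Fin (n + 1)) (AdeleRing (𝓞 K) K) := glDiagonal (n + 1) (AdeleRing (𝓞 K) K) T
  have hne : 𝔫P * 𝔫Q ≠ 0 := mul_ne_zero h𝔫P h𝔫Q
  have hsupp' : ∀ w : HeightOneSpectrum (𝓞 K), w.asIdeal ∣ 𝔫P * 𝔫Q → w ∈ S₀ := fun w h => by_contra fun hw => hsupp w hw h
  obtain ⟨S₁₀, hS₀S₁₀, hD'int, hDint⟩ := stub_gap_lsd_integral_places S₀ τ T hD'S₀ hDS₀
  /- (0) conjugation control `D_f⁻¹ K_f(𝔫P 𝔞P) D_f ≤ K_f(𝔫P)`, `D'_f⁻¹ K_f(𝔫Q 𝔞Q) D'_f ≤ K_f(𝔫Q)`, `𝔞P, 𝔞Q | S₁₀^∞` -/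
  obtain ⟨kP, -, hconjP⟩ :=
    InitialVectorTranslateNeZero.exists_forall_conj_mem_finitePrincipalCongruenceLevel S₁₀ h𝔫P hDint
  obtain ⟨kQ, -, hconjQ⟩ :=
    InitialVectorTranslateNeZero.exists_forall_conj_mem_finitePrincipalCongruenceLevel S₁₀ h𝔫Q hD'int
  have h𝔞P : (∏ v ∈ S₁₀, v.asIdeal ^ kP v : Ideal (𝓞 K)) ≠ 0 :=
    Finset.prod_ne_zero_iff.2 fun v _ => pow_ne_zero _ v.ne_bot
  have h𝔞Q : (∏ v ∈ S₁₀, v.asIdeal ^ kQ v : Ideal (𝓞 K)) ≠ 0 :=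
    Finset.prod_ne_zero_iff.2 fun v _ => pow_ne_zero _ v.ne_bot
  /- (1) the initial pure tensors `f₁ = Ŝ₁ e ∈ π`, `f₁' = Ŝ₁' e' ∈ σ` and their levels -/
  set f₁ : P.1.toSubmodule := corestrictW (mem_archIntertwiners_of_mem_multiplicityModule S₁.2) (e : E)
  set f₁' : Q.1.toSubmodule := corestrictW (mem_archIntertwiners_of_mem_multiplicityModule S₁'.2) (e' : E')
  have hf₁U : ∀ u ∈ finitePrincipalCongruenceLevel (n + 1) K 𝔫P,
      P.1.toContRep (GLn.ofFinite (n + 1) K u) f₁ = f₁ := fun u hu =>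
    TranslateArchValue.toContRep_ofFinite_corestrictW_eq_self hS₁ _ hu (e : E)
  have hf₁'U : ∀ u ∈ finitePrincipalCongruenceLevel (m + 1) K 𝔫Q,
      Q.1.toContRep (GLn.ofFinite (m + 1) K u) f₁' = f₁' := fun u hu =>
    TranslateArchValue.toContRep_ofFinite_corestrictW_eq_self hS₁' _ hu (e' : E')
  have hf₁fix : ∀ g ∈ principalCongruenceLevel (n + 1) K 𝔫P, P.1.toContRep g f₁ = f₁ :=
    LocalSingleDatum.toContRep_eq_self_of_forall_ofFinite P.1 hf₁U
  have hf₁'fix : ∀ g ∈ principalCongruenceLevel (m + 1) K 𝔫Q, Q.1.toContRep g f₁' = f₁' :=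
    LocalSingleDatum.toContRep_eq_self_of_forall_ofFinite Q.1 hf₁'U
  /- (2) Harish-Chandra's level-fixing bump `β` for `f₁` at level `U₀ = K_f(𝔫P)` (on `GL_n`) -/
  have hU₀o := isOpen_finitePrincipalCongruenceLevel (n + 1) K h𝔫P
  have hU₀c := isCompact_finitePrincipalCongruenceLevel (n + 1) K h𝔫P
  obtain ⟨β, hβc, hβs, hβsm, hfixP, -⟩ :=
    ArchLevelWeightFixingPair.stub_archLevelWeight_fixing_pair hcpt P P (Or.inr rfl) hU₀o hU₀c f₁ f₁
      (LocalSingleDatum.finiteDimensional_span_corestrictW _ (e : E) hefin)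
      (LocalSingleDatum.finiteDimensional_span_corestrictW _ (e : E) hefin) hf₁U hf₁U
  /- (3) the spread datum from the initial datum `(𝔫P, f₁)` with `T₀ := S₀` and partner level `𝔫Q` -/
  obtain ⟨T₁, hS₀T₁, hT₁sub, m₀, -, 𝔫, h𝔫, h𝔫Qdvd, -, hprimes, c, e_, ϖ, L, hL, hnd, hLT, hrad, f, hf, hffix, hβpart⟩ :=
    SpreadPairDatumOfInitialDatum.stub_spreadPairDatum_of_initialDatum P S₀ (𝔫' := 𝔫Q) (𝔫₁ := 𝔫P)
      h𝔫Q h𝔫P f₁ hf₁fix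
  have hT₁S₀ : T₁ ⊆ S₀ := fun v hv => (hT₁sub v hv).elim id fun h => hsupp' v h
  obtain rfl : S₀ = T₁ := Finset.Subset.antisymm hS₀T₁ hT₁S₀
  have hKo := isOpen_finitePrincipalCongruenceLevel (n + 1) K h𝔫
  have hKc := isCompact_finitePrincipalCongruenceLevel (n + 1) K h𝔫
  have hKo' := isOpen_finitePrincipalCongruenceLevel (m + 1) K h𝔫
  have hKc' := isCompact_finitePrincipalCongruenceLevel (m + 1) K h𝔫
  obtain ⟨_, a, rfl, -, ha, -, -, hsmooth₁, -⟩ := hβpart hβc hβs hβsm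
  rw [hfixP, ← hf] at hsmooth₁
  have hβ₂c : Continuous (a⁻¹ • β) := hβc.const_smul a⁻¹
  have hβ₂s : HasCompactSupport (a⁻¹ • β) := hβs.mono (Function.support_const_smul_subset a⁻¹ β)
  have hβ₂sm : ∀ u : GL (Fin (n + 1)) (mixedSpace K), ContDiff ℝ ∞
      fun X : (archGroupGL (n + 1) K).lie.toSubmodule =>
        (a⁻¹ • β) (u * expGL (X : Matrix (Fin (n + 1)) (Fin (n + 1)) (mixedSpace K))) := fun u =>
    (hβsm u).const_smul a⁻¹
  obtain ⟨_, -, rfl, hη, -, hηleft, -, -, hblock⟩ := hβpart hβ₂c hβ₂s hβ₂sm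
  have hsmoothf : smoothedVector P.1 (archLevelWeight (finitePrincipalCongruenceLevel (n + 1) K 𝔫) (a⁻¹ • β)) f = f := by
    rw [CornerLocalSingleDatum.smoothedVector_archLevelWeight_smul, hsmooth₁, smul_smul, Complex.ofReal_inv,
      inv_mul_cancel₀ (Complex.ofReal_ne_zero.2 ha.ne'), one_smul]
  have hsmoothf1 : smoothedVector P.1 (archLevelWeight (finitePrincipalCongruenceLevel (n + 1) K 𝔫) (a⁻¹ • β)) f =
      (1 : ℂ) • f := by rw [one_smul]; exact hsmoothf
  /- (4) the partner `f' := f₁'` and its level-fixing bump `β'` directly at level `K_f(𝔫)` (on `GL_m`) -/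
  have hK𝔫 : finitePrincipalCongruenceLevel (m + 1) K 𝔫 ≤ finitePrincipalCongruenceLevel (m + 1) K 𝔫Q :=
    fun u hu => mem_finitePrincipalCongruenceLevel_iff.2
      (principalCongruenceLevel_mono (m + 1) K h𝔫 (Ideal.le_of_dvd h𝔫Qdvd) (mem_finitePrincipalCongruenceLevel_iff.1 hu))
  have hf₁'K𝔫 : ∀ u ∈ finitePrincipalCongruenceLevel (m + 1) K 𝔫, Q.1.toContRep (GLn.ofFinite (m + 1) K u) f₁' = f₁' :=
    fun u hu => hf₁'U u (hK𝔫 hu)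
  obtain ⟨β', hβ'c, hβ's, hβ'sm, hfixQ, -⟩ :=
    ArchLevelWeightFixingPair.stub_archLevelWeight_fixing_pair hcpt' Q Q (Or.inr rfl) hKo' hKc' f₁' f₁'
      (LocalSingleDatum.finiteDimensional_span_corestrictW _ (e' : E') he'fin)
      (LocalSingleDatum.finiteDimensional_span_corestrictW _ (e' : E') he'fin) hf₁'K𝔫 hf₁'K𝔫
  have hη' : IsTestFunctionGL (m + 1) K (archLevelWeight (finitePrincipalCongruenceLevel (m + 1) K 𝔫) β') :=
    isTestFunctionGL_archLevelWeight hβ'c hβ's hβ'sm hKo' hKc'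
  have hη'left : ∀ u ∈ finitePrincipalCongruenceLevel (m + 1) K 𝔫, ∀ g : GL (Fin (m + 1)) (AdeleRing (𝓞 K) K),
      archLevelWeight (finitePrincipalCongruenceLevel (m + 1) K 𝔫) β' (GLn.ofFinite (m + 1) K u * g) =
        archLevelWeight (finitePrincipalCongruenceLevel (m + 1) K 𝔫) β' g := fun u hu g =>
    archLevelWeight_ofFinite_mul β' hu g
  have hsmoothf'1 : smoothedVector Q.1 (archLevelWeight (finitePrincipalCongruenceLevel (m + 1) K 𝔫) β') f₁' =
      (1 : ℂ) • f₁' := by rw [one_smul]; exact hfixQ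
  /- (5) HONESTY: `S_η f` and `S_{η'} f₁'` are cusp forms -/
  obtain ⟨TL, hTL, hTLa⟩ := exists_spreadIter_intertwiner h𝔫P hL hnd hS₁
  have hfTL : f = corestrictW hTL.1 (e : E) := by
    refine Subtype.ext (show ((f : P.1.toSubmodule) : (AdelicGroupData.gl (n + 1) K).L2 μ) = TL (e : E) from ?_)
    rw [hTLa, hf]
  have hffin : FiniteDimensional ℂ (Submodule.span ℂ (Set.range
      fun k : (AutomorphyDatum.gl (n + 1) K hcpt).arch.maximalCompact =>
        P.1.toContRep ((AutomorphyDatum.gl (n + 1) K hcpt).ofK k) f)) := by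
    rw [hfTL]; exact LocalSingleDatum.finiteDimensional_span_corestrictW hTL.1 (e : E) hefin
  have hUP : (finitePrincipalCongruenceLevel (n + 1) K 𝔫).map (GLn.ofFiniteAdelic (n + 1) K) ∈
      (AutomorphyDatum.gl (n + 1) K hcpt).finiteLevels := ⟨_, hKo, hKc, rfl⟩
  have hUQ : (finitePrincipalCongruenceLevel (m + 1) K 𝔫).map (GLn.ofFiniteAdelic (m + 1) K) ∈
      (AutomorphyDatum.gl (m + 1) K hcpt').finiteLevels := ⟨_, hKo', hKc', rfl⟩
  obtain ⟨-, -, hcuspP, hRP⟩ := exists_memLp_toLp_eq_isCuspFormGL_of_smoothedVector_eq hcpt P hUP hη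
    (by rintro _ ⟨u, hu, rfl⟩ g; exact hηleft u hu g) hsmoothf hffin
  obtain ⟨-, -, hcuspQ, hRQ⟩ := exists_memLp_toLp_eq_isCuspFormGL_of_smoothedVector_eq hcpt' Q hUQ hη'
    (by rintro _ ⟨u, hu, rfl⟩ g; exact hη'left u hu g) hfixQ
    (LocalSingleDatum.finiteDimensional_span_corestrictW _ (e' : E') he'fin)
  have haeP := smoothedVector_ae_eq P.1 hη.continuous hη.hasCompactSupport f
  have haeQ := smoothedVector_ae_eq Q.1 hη'.continuous hη'.hasCompactSupport f₁'
  rw [hsmoothf] at haeP; rw [hfixQ] at haeQ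
  /- (6) the abstract properties of `W = W_{S_η f}` (on `GL_n`) and `W' = W_{S_{η'} f₁'}` (on `GL_m`) -/
  obtain ⟨hWN, hWZ, hWK, -, hWc⟩ :=
    WhittakerCoeffSmoothedFormProps.stub_whittakerCoeff_smoothedForm_props P ν₀ (𝔫 := 𝔫) (𝔫' := 𝔫) h𝔫 hη f hffix
  obtain ⟨hW'N, -, hW'K, hW'loc, hW'c⟩ :=
    WhittakerCoeffSmoothedFormProps.stub_whittakerCoeff_smoothedForm_props Q ν₀' (𝔫 := 𝔫) (𝔫' := 𝔫Q) h𝔫Q hη'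
      f₁' hf₁'fix
  set W : GL (Fin (n + 1)) (AdeleRing (𝓞 K) K) → ℂ := whittakerCoeff ν₀ (unipotentTateDomain (n + 1) K) (adeleAddChar K)
    (invQuot (AdelicGroupData.gl (n + 1) K) (smoothedForm (archLevelWeight (finitePrincipalCongruenceLevel (n + 1) K 𝔫) (a⁻¹ • β))
      ((f : P.1.toSubmodule) : (AdelicGroupData.gl (n + 1) K).L2 μ)))
  set W' : GL (Fin (m + 1)) (AdeleRing (𝓞 K) K) → ℂ := whittakerCoeff ν₀' (unipotentTateDomain (m + 1) K) (adeleAddChar K)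
    (invQuot (AdelicGroupData.gl (m + 1) K) (smoothedForm (archLevelWeight (finitePrincipalCongruenceLevel (m + 1) K 𝔫) β')
      ((f₁' : Q.1.toSubmodule) : (AdelicGroupData.gl (m + 1) K).L2 μ')))
  /- (7) support collapse and product form of the gap pair on the unit box (the GRANTED neighbour stub) -/
  obtain ⟨𝔪, h𝔪, F, hFinv, hF01, hF1, hIF⟩ :=
    hPF hm hmn W W' hWN hW'N hWZ h𝔫 hWK (fun u hu g => hW'K u (hK𝔫 hu) g) hprimes τ hD'S₀ T hDS₀
      (fun v hv => by
        obtain ⟨tv, M, c₀, hsp, hψ, hM1, hcnt, hmono, hgap, -⟩ := hblock ν₀ inferInstance v hv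
        refine ⟨tv, M, c₀, hsp, hψ, hM1, hmono, hgap, fun κ hκ g =>
          hW'loc v κ (valuedCongruenceSubgroup_mono (Fin (m + 1)) ?_ hκ) g⟩
        rw [idealRadius_eq_exp_neg_natCast v h𝔫Q, exp_le_exp, neg_le_neg_iff]; exact hcnt) νA νK
  /- (8) the archimedean values of `W` at `D (h, 1)` and of `W'` at `D' (h, 1)` -/
  have hrad₁ : ∀ v ∈ L, exp (-e_ v) ≤ idealRadius K v 𝔫P := fun v hv =>
    (hrad v hv).trans (idealRadius_mono K v hne Ideal.mul_le_right)
  have hDL : ∀ v ∈ L, localComponent v D = 1 := fun v hv => hDS₀ v ((hLT v).1 hv)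
  have h𝔞PL : ∀ v ∈ L, ¬ v.asIdeal ∣ ∏ w ∈ S₁₀, w.asIdeal ^ kP w := fun v hv hdvd =>
    hS₀S₁₀ v ((hLT v).1 hv) (LocalSingleDatum.mem_of_dvd_prod_pow kP hdvd)
  have hAval : ∀ h : GL (Fin (n + 1)) (mixedSpace K), W (D * GLn.ofInfinite (n + 1) K h) = (1 : ℂ) *
      transferMap (whittakerFunctional ν₀ (continuous_adeleAddChar K) (ContRepresentation.Equiv.refl P.1.toContRep)) hτPc
        (finComponentRep hcpt τP P.1 (GLn.sndHom (n + 1) K D) S₁)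
        ⟨τP (toArch hcpt h) (e : E), apply_mem_archGardingSpace hτPc _ e.2⟩ := fun h =>
    TranslateArchValue.stub_translate_arch_value hcpt P hτPc ν₀ h𝔫P S₁ hS₁ e hL hnd hrad₁ D hDL hDinf h𝔞P h𝔞PL hconjP
      hη f hf hsmoothf1 h
  have hBval : ∀ h : GL (Fin (m + 1)) (mixedSpace K), W' (D' * GLn.ofInfinite (m + 1) K h) = (1 : ℂ) *
      transferMap (whittakerFunctional ν₀' (continuous_adeleAddChar K) (ContRepresentation.Equiv.refl Q.1.toContRep)) hτQc
        (finComponentRep hcpt' τQ Q.1 (GLn.sndHom (m + 1) K D') S₁')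
        ⟨τQ (toArch hcpt' h) (e' : E'), apply_mem_archGardingSpace hτQc _ e'.2⟩ := fun h =>
    TranslateArchValue.stub_translate_arch_value hcpt' Q hτQc ν₀' h𝔫Q S₁' hS₁' e' (c := c) (e := e_) (ϖ := ϖ)
      (L := []) (fun v hv => by simp at hv) List.nodup_nil (fun v hv => by simp at hv) D' (fun v hv => by simp at hv)
      hD'inf h𝔞Q (fun v hv => by simp at hv) hconjQ hη' f₁' rfl hsmoothf'1 h
  /- (9) coset averaging on `GL_m` -/
  set A : GL (Fin (m + 1)) (mixedSpace K) → ℂ := fun x =>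
    W (D * GLn.ofInfinite (n + 1) K (glCorner (mixedSpace K) hmn.le x)) with hAdef
  set B : GL (Fin (m + 1)) (mixedSpace K) → ℂ := fun x => conj (W' (D' * GLn.ofInfinite (m + 1) K x)) with hBdef
  have hA : Continuous A := hWc.comp (continuous_const.mul
    ((GLn.continuous_ofInfinite (n + 1) K).comp (continuous_glCorner (R := mixedSpace K) hmn.le)))
  have hB : Continuous B :=
    Complex.continuous_conj.comp (hW'c.comp (continuous_const.mul (GLn.continuous_ofInfinite (m + 1) K)))
  set I : ℂ → (Fin (m + 1) → ideleGroup K) × ↥(maximalCompactAdelic (m + 1) K) → ℂ := fun s =>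
    torusPairIntegrandC (m + 1) K (fun g => W (D * glCorner (AdeleRing (𝓞 K) K) hmn.le g))
      (fun g => star W' (D' * g)) (fun _ => (1 : ℝ)) s
  have hprod : ∀ (s : ℂ) (p : (Fin (m + 1) → ideleGroup K) × ↥(maximalCompactAdelic (m + 1) K)),
      p.1 ∈ unitBox (n := m + 1) (K := K) (Set.univ : Set (HeightOneSpectrum (𝓞 K))) →
      I s p = F (GLn.sndHom (m + 1) K (torusPoint (m + 1) K p)) *
        (A (GLn.toMixed (m + 1) K (torusPoint (m + 1) K p)) * B (GLn.toMixed (m + 1) K (torusPoint (m + 1) K p)) *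
          archTorusWeightC (m + 1) K s (archTorusOfIdele (m + 1) K p.1)) := fun s p hp =>
    (hIF s).2 p hp
  set I' := fun (Φinf : (Fin (m + 1) → InfiniteAdeleRing K) → ℝ) (s : ℂ)
      (p : (Fin (m + 1) → ideleGroup K) × ↥(maximalCompactAdelic (m + 1) K)) =>
    I s p * ((Φinf (archLastRow (m + 1) K (GLn.toMixed (m + 1) K (torusPoint (m + 1) K p))) : ℝ) : ℂ) with hI'def
  obtain ⟨r, hr, havg⟩ :=
    UnitBoxTranslateAvg.stub_unitBox_translate_avg hcpt' νA νK h𝔪 F hFinv 1 hF01 hF1 A B hA hB I'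
      (fun Φinf s p hp => by rw [hI'def]; dsimp only; rw [hprod s p hp]; ring)
  /- (10) the datum -/
  refine ⟨𝔫, h𝔫, fun w hw h => hw (hprimes w h), _, _, f, f₁',
    continuous_smoothedForm hη.continuous hη.hasCompactSupport _,
    continuous_smoothedForm hη'.continuous hη'.hasCompactSupport _, haeP, haeQ, hcuspP, hcuspQ,
    CornerLocalSingleDatum.isRightInvariant_of_map hRP, CornerLocalSingleDatum.isRightInvariant_of_map hRQ, r, hr,
    fun s => ?_⟩
  have h2 : ∫ p in unitBox (Set.univ : Set (HeightOneSpectrum (𝓞 K))) ×ˢ Set.univ, I s p ∂(νA.prod νK) =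
      ∫ p in unitBox (Set.univ : Set (HeightOneSpectrum (𝓞 K))) ×ˢ Set.univ, I' (fun _ => (1 : ℝ)) s p ∂(νA.prod νK) := by
    refine integral_congr_ae (Eventually.of_forall fun p => ?_)
    rw [hI'def]; dsimp only; rw [Complex.ofReal_one, mul_one]
  refine ((hIF s).1.trans h2).trans ((havg (fun _ => (1 : ℝ)) continuous_const s).trans ?_)
  rw [archGapPairIntegralCplx_def, ← integral_const_mul, ← integral_const_mul]
  refine integral_congr_ae (Eventually.of_forall fun z => ?_)
  rw [hAdef, hBdef]
  dsimp only
  rw [hAval, hBval]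
  simp only [one_mul, mul_one, Complex.ofReal_one]
  rfl

end Summit.Langlands.Langlands.Theorems.GapLocalSingleDatum

end
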